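import Mathlib.Analysis.Complex.AbsMax
import Mathlib.Analysis.Complex.ReImTopology
import Mathlib.Analysis.SpecialFunctions.Complex.LogDeriv
import Literature.NumberTheory.LFunctions.BookerLemmaBoundary
import HarnessLib

/-!
# Booker's lemma (Trudgian 2011, Lemma 2.10) — proof, part 3: maximum principle and discharge

We finish the proof of the named fact
`Literature.NumberTheory.LFunctions.Trudgian2011_lemma_2_10` (file `BookerLemma.lean`):

* `H = 𝓕 − log 4 · g` is analytic on the open upper half plane and continuous on the closed upper
  half plane away from the poles `±1` of `g` (principal logarithms with arguments in the upper
  half plane are continuous from above at negative reals; `w log w → 0` at `0`);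
* **maximum modulus** (`Complex.norm_le_of_forall_mem_frontier_norm_le`) for
  `f_ε = exp(H) · m_ε`, `m_ε(z) = (z−1)(z+1)/((z−1+iε)(z+1+iε))` (`|m_ε| ≤ 1` on `Im z ≥ 0`,
  `m_ε(±1) = 0`, which regularises the corners where `g` has its poles) on the rectangles
  `(−1,1) × (0,T)`, using the boundary estimates of `BookerLemmaBoundary.lean`; letting `ε → 0`
  and `T → ∞` gives `Re H ≤ 0` on the half-strip `|Re z| < 1`, `Im z > 0` (`bookerH_re_nonpos`);
* the scaling `z = w/d` (`|Re z| ≤ 1/(2d) < 1`), conjugation symmetry for `Im z < 0` and the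
  real-axis evaluation give `Trudgian2011_lemma_2_10_holds` (and Booker's `d = 1` case).

This replaces the numerical step of Booker's published sketch by the elementary side estimate
of part 2, and carries out Trudgian's "straightforward adaptation" to `½ < d ≤ 1` via the
scaling, which needs Booker's inequality on the wider strip `|Re z| < 1`.

## References

* A. R. Booker, *Artin's conjecture, Turing's method, and the Riemann hypothesis*, Experiment.
  Math. 15 (2006), 385–407, Lemma 4.4 (proof sketch).  [Booker2006]
* T. S. Trudgian, *Improvements to Turing's method*, Math. Comp. 80 (2011), Lemma 2.10.
  [Trudgian2011]
-/

noncomputable section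

open Complex MeasureTheory intervalIntegral Filter Set
open scoped ComplexConjugate Topology

namespace Literature.NumberTheory.LFunctions

/-! ### `w log w` and continuity of `𝓕` on the closed upper half plane -/

/-- `‖w log w‖ ≤ |‖w‖ log ‖w‖| + π ‖w‖`. [folklore] -/
theorem norm_mul_clog_le (w : ℂ) : ‖w * log w‖ ≤ |‖w‖ * Real.log ‖w‖| + Real.pi * ‖w‖ := by
  rw [norm_mul]
  have h1 : ‖log w‖ ≤ |(log w).re| + |(log w).im| := Complex.norm_le_abs_re_add_abs_im _
  rw [Complex.log_re, Complex.log_im] at h1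
  have h2 : |arg w| ≤ Real.pi := Complex.abs_arg_le_pi w
  have hn := norm_nonneg w
  calc ‖w‖ * ‖log w‖ ≤ ‖w‖ * (|Real.log ‖w‖| + Real.pi) := by gcongr; linarith
    _ = |‖w‖ * Real.log ‖w‖| + Real.pi * ‖w‖ := by rw [abs_mul, abs_of_nonneg hn]; ring

/-- `w log w → 0` as `w → 0`: `w ↦ w log w` is continuous at `0` (value `0`). [folklore] -/
theorem continuousAt_mul_clog_zero : ContinuousAt (fun w : ℂ => w * log w) 0 := by
  rw [ContinuousAt, zero_mul]
  refine squeeze_zero_norm (fun w => norm_mul_clog_le w) ?_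
  have hc : Continuous fun w : ℂ => |‖w‖ * Real.log ‖w‖| + Real.pi * ‖w‖ :=
    ((Real.continuous_mul_log.comp continuous_norm).abs).add (continuous_const.mul continuous_norm)
  have := hc.tendsto 0
  simpa using this

/-- `w ↦ w log w` (principal branch) is continuous *from the closed upper half plane* at every
point of it. [folklore] -/
theorem continuousWithinAt_mul_clog_upper (w₀ : ℂ) :
    ContinuousWithinAt (fun w : ℂ => w * log w) {w : ℂ | 0 ≤ w.im} w₀ := by
  by_cases h : w₀ ∈ slitPlane
  · exact (continuousAt_id.mul (continuousAt_clog h)).continuousWithinAt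
  · rw [mem_slitPlane_iff, not_or, not_lt, not_ne_iff] at h
    rcases h.1.lt_or_eq with hlt | heq
    · exact continuousWithinAt_id.mul (continuousWithinAt_log_of_re_neg_of_im_zero hlt h.2)
    · have : w₀ = 0 := Complex.ext heq h.2
      rw [this]
      exact continuousAt_mul_clog_zero.continuousWithinAt

/-- Shifted version: `z ↦ (z + a) log(z + a)` for real `a`. [folklore] -/
theorem continuousWithinAt_mul_clog_add_upper (z₀ : ℂ) {a : ℂ} (ha : a.im = 0) :
    ContinuousWithinAt (fun z : ℂ => (z + a) * log (z + a)) {z : ℂ | 0 ≤ z.im} z₀ := by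
  have hmaps : MapsTo (fun z : ℂ => z + a) {z : ℂ | 0 ≤ z.im} {w : ℂ | 0 ≤ w.im} := by
    intro z hz
    simp only [mem_setOf_eq, add_im, ha, add_zero] at hz ⊢
    exact hz
  exact ContinuousWithinAt.comp (g := fun w : ℂ => w * log w) (f := fun z : ℂ => z + a)
    (continuousWithinAt_mul_clog_upper (z₀ + a))
    (by fun_prop : Continuous fun z : ℂ => z + a).continuousWithinAt hmaps

/-- Shifted version: `z ↦ (z − a) log(z − a)` for real `a`. [folklore] -/
theorem continuousWithinAt_mul_clog_sub_upper (z₀ : ℂ) {a : ℂ} (ha : a.im = 0) :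
    ContinuousWithinAt (fun z : ℂ => (z - a) * log (z - a)) {z : ℂ | 0 ≤ z.im} z₀ := by
  have := continuousWithinAt_mul_clog_add_upper z₀ (a := -a) (by simp [ha])
  simpa [sub_eq_add_neg] using this

/-- `𝓕` is continuous on the closed upper half plane (from within). [folklore] -/
theorem continuousWithinAt_bookerF_upper (z₀ : ℂ) :
    ContinuousWithinAt bookerF {z : ℂ | 0 ≤ z.im} z₀ := by
  have h2a := continuousWithinAt_mul_clog_add_upper z₀ (a := 2) (by simp)
  have h2s := continuousWithinAt_mul_clog_sub_upper z₀ (a := 2) (by simp)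
  have h1a := continuousWithinAt_mul_clog_add_upper z₀ (a := 1) (by simp)
  have h1s := continuousWithinAt_mul_clog_sub_upper z₀ (a := 1) (by simp)
  show ContinuousWithinAt (fun z : ℂ => (z + 2) * log (z + 2) - (z - 2) * log (z - 2)
    - 2 * ((z + 1) * log (z + 1)) + 2 * ((z - 1) * log (z - 1))) {z : ℂ | 0 ≤ z.im} z₀
  exact ((h2a.sub h2s).sub (continuousWithinAt_const.mul h1a)).add
    (continuousWithinAt_const.mul h1s)

/-- `𝓕` is complex differentiable off the real axis. [folklore] -/
theorem differentiableAt_bookerF {z : ℂ} (hz : z.im ≠ 0) : DifferentiableAt ℂ bookerF z := by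
  have hs : ∀ a : ℝ, z + a ∈ slitPlane := fun a =>
    mem_slitPlane_iff.mpr (Or.inr (by simpa using hz))
  have hs' : ∀ a : ℝ, z - a ∈ slitPlane := fun a =>
    mem_slitPlane_iff.mpr (Or.inr (by simpa using hz))
  have t1 : ∀ a : ℝ, DifferentiableAt ℂ (fun z : ℂ => (z + a) * log (z + a)) z := fun a =>
    (differentiableAt_id.add_const _).mul ((differentiableAt_id.add_const _).clog (hs a))
  have t2 : ∀ a : ℝ, DifferentiableAt ℂ (fun z : ℂ => (z - a) * log (z - a)) z := fun a =>
    (differentiableAt_id.sub_const _).mul ((differentiableAt_id.sub_const _).clog (hs' a))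
  have h2a := t1 2
  have h2s := t2 2
  have h1a := t1 1
  have h1s := t2 1
  push_cast at h2a h2s h1a h1s
  show DifferentiableAt ℂ (fun z : ℂ => (z + 2) * log (z + 2) - (z - 2) * log (z - 2)
    - 2 * ((z + 1) * log (z + 1)) + 2 * ((z - 1) * log (z - 1))) z
  exact ((h2a.sub h2s).sub (h1a.const_mul 2)).add (h1s.const_mul 2)

/-- `g` is complex differentiable away from `±1`. [folklore] -/
theorem differentiableAt_bookerG {z : ℂ} (h1 : 1 + z ≠ 0) (h2 : 1 - z ≠ 0) :
    DifferentiableAt ℂ bookerG z := by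
  show DifferentiableAt ℂ (fun z : ℂ => 1 / (1 + z) + 1 / (1 - z)) z
  refine DifferentiableAt.add ?_ ?_
  · exact (differentiableAt_const _).div (differentiableAt_id.const_add _) h1
  · exact (differentiableAt_const _).div (differentiableAt_id.const_sub _) h2

/-- `H` is complex differentiable off the real axis. [folklore] -/
theorem differentiableAt_bookerH {z : ℂ} (hz : z.im ≠ 0) : DifferentiableAt ℂ bookerH z := by
  have h1 : 1 + z ≠ 0 := fun h => hz (by simpa using congrArg Complex.im h)
  have h2 : 1 - z ≠ 0 := fun h => hz (by
    have := congrArg Complex.im h; simp at this; linarith)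
  show DifferentiableAt ℂ (fun z => bookerF z - (Real.log 4 : ℝ) * bookerG z) z
  exact (differentiableAt_bookerF hz).sub ((differentiableAt_bookerG h1 h2).const_mul _)

/-- `H` is continuous from the closed upper half plane at every point other than `±1`.
[folklore] -/
theorem continuousWithinAt_bookerH_upper {z₀ : ℂ} (h1 : 1 + z₀ ≠ 0) (h2 : 1 - z₀ ≠ 0) :
    ContinuousWithinAt bookerH {z : ℂ | 0 ≤ z.im} z₀ := by
  have hG : ContinuousAt bookerG z₀ := (differentiableAt_bookerG h1 h2).continuousAt
  show ContinuousWithinAt (fun z => bookerF z - (Real.log 4 : ℝ) * bookerG z) {z : ℂ | 0 ≤ z.im} z₀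
  exact (continuousWithinAt_bookerF_upper z₀).sub
    (continuousWithinAt_const.mul hG.continuousWithinAt)

/-- `Re H ≤ ‖𝓕‖` on the closed strip `|Re z| ≤ 1` (the `g`-term has non-negative real part
there). [folklore] -/
theorem bookerH_re_le_norm_bookerF {z : ℂ} (hz : |z.re| ≤ 1) : (bookerH z).re ≤ ‖bookerF z‖ := by
  rw [bookerH_re]
  have hG : 0 ≤ (bookerG z).re := by
    have := bookerG_re_nonneg (T := z.im) hz
    rwa [re_add_im] at this
  have hF : (bookerF z).re ≤ ‖bookerF z‖ := Complex.re_le_norm _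
  nlinarith [real_log_four_pos]

/-! ### The corner regulariser `m_ε` -/

/-- For `Im z ≥ 0` and `ε > 0`, `z + c + iε ≠ 0` (`c` real). [folklore] -/
theorem add_add_eps_I_ne_zero {z : ℂ} (hz : 0 ≤ z.im) (c : ℝ) {ε : ℝ} (hε : 0 < ε) :
    z + c + ε * I ≠ 0 := by
  intro h
  have := congrArg Complex.im h
  simp at this
  linarith

/-- `|z + c| ≤ |z + c + iε|` for `Im z ≥ 0`, `ε > 0`, `c` real. [folklore] -/
theorem norm_add_le_norm_add_eps {z : ℂ} (hz : 0 ≤ z.im) (c : ℝ) {ε : ℝ} (hε : 0 < ε) :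
    ‖z + c‖ ≤ ‖z + c + ε * I‖ := by
  have e1 : z + c = ((z.re + c : ℝ) : ℂ) + z.im * I := by
    apply Complex.ext <;> simp
  have e2 : z + c + ε * I = ((z.re + c : ℝ) : ℂ) + ((z.im + ε : ℝ) : ℂ) * I := by
    apply Complex.ext <;> simp
  rw [e2, e1, Complex.norm_add_mul_I, Complex.norm_add_mul_I]
  apply Real.sqrt_le_sqrt
  nlinarith

/-- `|m_ε(z)| ≤ 1` on the closed upper half plane. [folklore] -/
theorem norm_cornerFactor_le_one {z : ℂ} (hz : 0 ≤ z.im) {ε : ℝ} (hε : 0 < ε) :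
    ‖(z - 1) * (z + 1) / ((z - 1 + ε * I) * (z + 1 + ε * I))‖ ≤ 1 := by
  have ha := norm_add_le_norm_add_eps hz (-1) hε
  have hb := norm_add_le_norm_add_eps hz 1 hε
  push_cast at ha hb
  rw [← sub_eq_add_neg] at ha
  have hne1 : z - 1 + ε * I ≠ 0 := by
    have := add_add_eps_I_ne_zero hz (-1) hε; push_cast at this; rwa [← sub_eq_add_neg] at this
  have hne2 : z + 1 + ε * I ≠ 0 := by
    have := add_add_eps_I_ne_zero hz 1 hε; push_cast at this; exact this
  rw [norm_div, norm_mul, norm_mul]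
  refine div_le_one_of_le₀ ?_ (by positivity)
  exact mul_le_mul ha hb (norm_nonneg _) (norm_nonneg _)

/-! ### The maximum principle on the half-strip -/

/-- **Booker's inequality in the upper half-strip** (Booker 2006, Lemma 4.4, via the maximum
modulus principle): `Re H(z) ≤ 0` for `|Re z| < 1`, `Im z > 0`.
[cite: Booker2006, Lemma 4.4 (proof: "by … the maximum modulus principle applied to the
function e^{f(w) − (log 4) g(w)} on the rectangle …")] -/
theorem bookerH_re_nonpos {z : ℂ} (hzi : 0 < z.im) (hzr : |z.re| < 1) : (bookerH z).re ≤ 0 := by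
  have hz1 : 1 + z ≠ 0 := fun h => hzi.ne' (by simpa using congrArg Complex.im h)
  have hz2 : 1 - z ≠ 0 := fun h => hzi.ne' (by
    have := congrArg Complex.im h; simp at this; linarith)
  have hzm1 : z - 1 ≠ 0 := fun h => hzi.ne' (by simpa using congrArg Complex.im h)
  have hzp1 : z + 1 ≠ 0 := fun h => hzi.ne' (by simpa using congrArg Complex.im h)
  -- Step 1: maximum modulus for `f_ε = exp H · m_ε` on the rectangle `(-1,1) × (0,T)`.
  have step1 : ∀ T : ℝ, z.im < T → ∀ ε : ℝ, 0 < ε →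
      Real.exp (bookerH z).re * ‖(z - 1) * (z + 1) / ((z - 1 + ε * I) * (z + 1 + ε * I))‖
        ≤ Real.exp (5 / T ^ 2) := by
    intro T hT ε hε
    have hT0 : 0 < T := hzi.trans hT
    set U : Set ℂ := (Ioo (-1 : ℝ) 1) ×ℂ (Ioo 0 T) with hU
    set m : ℂ → ℂ := fun w => (w - 1) * (w + 1) / ((w - 1 + ε * I) * (w + 1 + ε * I)) with hm
    set f : ℂ → ℂ := fun w => exp (bookerH w) * m w with hf
    have hUo : IsOpen U := isOpen_Ioo.reProdIm isOpen_Ioo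
    have hUb : Bornology.IsBounded U :=
      (Metric.isBounded_Ioo (-1 : ℝ) 1).reProdIm (Metric.isBounded_Ioo 0 T)
    have hclU : closure U = (Icc (-1 : ℝ) 1) ×ℂ (Icc 0 T) := by
      rw [hU, closure_reProdIm, closure_Ioo (by norm_num), closure_Ioo hT0.ne]
    have hcl_im : ∀ w ∈ closure U, 0 ≤ w.im := fun w hw => by
      rw [hclU, mem_reProdIm] at hw; exact hw.2.1
    have hcl_re : ∀ w ∈ closure U, |w.re| ≤ 1 := fun w hw => by
      rw [hclU, mem_reProdIm] at hw; exact abs_le.mpr hw.1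
    -- denominators of `m` do not vanish on the closed upper half plane
    have hden : ∀ w : ℂ, 0 ≤ w.im → (w - 1 + ε * I) * (w + 1 + ε * I) ≠ 0 := by
      intro w hw
      have h1 := add_add_eps_I_ne_zero hw (-1) hε
      have h2 := add_add_eps_I_ne_zero hw 1 hε
      push_cast at h1 h2
      rw [← sub_eq_add_neg] at h1
      exact mul_ne_zero h1 h2
    have hm_cont : ∀ w : ℂ, 0 ≤ w.im → ContinuousAt m w := by
      intro w hw
      rw [hm]
      have hd := hden w hw
      fun_prop (disch := exact hd)
    have hm_diff : ∀ w : ℂ, 0 ≤ w.im → DifferentiableAt ℂ m w := by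
      intro w hw
      rw [hm]
      have hd := hden w hw
      fun_prop (disch := exact hd)
    have hm_le : ∀ w : ℂ, 0 ≤ w.im → ‖m w‖ ≤ 1 := fun w hw => norm_cornerFactor_le_one hw hε
    have hm_one : m 1 = 0 := by simp [hm]
    have hm_negone : m (-1) = 0 := by simp [hm]
    have hnorm_f : ∀ w : ℂ, ‖f w‖ = Real.exp (bookerH w).re * ‖m w‖ := fun w => by
      rw [hf]; simp only [norm_mul, Complex.norm_exp]
    -- differentiability on `U`
    have hdiff : DifferentiableOn ℂ f U := by
      intro w hw
      rw [hU, mem_reProdIm] at hw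
      have hwi : 0 < w.im := hw.2.1
      have h := ((differentiableAt_bookerH hwi.ne').cexp).mul (hm_diff w hwi.le)
      exact h.differentiableWithinAt
    -- continuity on the closure
    have hcont : ContinuousOn f (closure U) := by
      intro w hw
      have hwi := hcl_im w hw
      have hsub : closure U ⊆ {z : ℂ | 0 ≤ z.im} := fun y hy => hcl_im y hy
      by_cases hcorner : 1 + w = 0 ∨ 1 - w = 0
      · -- at the corners `w = ∓1`, `f → 0 = f w` by the squeeze `‖f‖ ≤ e^M ‖m‖`
        have hw' : w = -1 ∨ w = 1 := by
          rcases hcorner with h | h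
          · left; linear_combination h
          · right; linear_combination -h
        have hfw : f w = 0 := by
          rcases hw' with h | h <;> simp [hf, h, hm_one, hm_negone]
        have hmw : m w = 0 := by rcases hw' with h | h <;> simp [h, hm_one, hm_negone]
        rw [ContinuousWithinAt, hfw]
        -- local bound for `‖𝓕‖` near `w` within the closed upper half plane
        have hFb : ∀ᶠ y in 𝓝[closure U] w, ‖bookerF y‖ < ‖bookerF w‖ + 1 := by
          have ht := ((continuousWithinAt_bookerF_upper w).norm).eventually
            (gt_mem_nhds (lt_add_one ‖bookerF w‖))
          exact nhdsWithin_mono w hsub ht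
        have hbound : ∀ᶠ y in 𝓝[closure U] w,
            ‖f y‖ ≤ Real.exp (‖bookerF w‖ + 1) * ‖m y‖ := by
          filter_upwards [hFb, self_mem_nhdsWithin] with y hy hyU
          rw [hnorm_f]
          have h1 := bookerH_re_le_norm_bookerF (hcl_re y hyU)
          gcongr
          linarith
        have hmt : Tendsto m (𝓝[closure U] w) (𝓝 0) := by
          rw [← hmw]; exact (hm_cont w hwi).continuousWithinAt.tendsto
        have hmt' : Tendsto (fun y => Real.exp (‖bookerF w‖ + 1) * ‖m y‖) (𝓝[closure U] w)
            (𝓝 0) := by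
          have := (hmt.norm).const_mul (Real.exp (‖bookerF w‖ + 1))
          simpa using this
        exact squeeze_zero_norm' hbound hmt'
      · push Not at hcorner
        have hH := (continuousWithinAt_bookerH_upper hcorner.1 hcorner.2).mono hsub
        exact (hH.cexp).mul (hm_cont w hwi).continuousWithinAt
    have hd : DiffContOnCl ℂ f U := ⟨hdiff, hcont⟩
    -- the bound on the frontier
    have hexp1 : 1 ≤ Real.exp (5 / T ^ 2) := Real.one_le_exp (by positivity)
    have hC : ∀ w ∈ frontier U, ‖f w‖ ≤ Real.exp (5 / T ^ 2) := by
      intro w hw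
      rw [hUo.frontier_eq] at hw
      have hwcl := hw.1
      have hwU : w ∉ U := hw.2
      have hwi := hcl_im w hwcl
      have hwr := hcl_re w hwcl
      rw [hclU, mem_reProdIm] at hwcl
      rw [hU, mem_reProdIm] at hwU
      rw [hnorm_f]
      have hmw := hm_le w hwi
      have hexp0 := Real.exp_pos (bookerH w).re
      -- case analysis on the position of `w` on the boundary
      rcases hwcl.2.1.lt_or_eq with hpos | hzero
      · rcases hwcl.2.2.lt_or_eq with hlt | htop
        · -- `0 < Im w < T`: then `Re w = ±1`
          have hre : w.re = 1 ∨ w.re = -1 := by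
            by_contra hcon
            push Not at hcon
            apply hwU
            refine ⟨⟨lt_of_le_of_ne hwcl.1.1 (Ne.symm hcon.2), lt_of_le_of_ne hwcl.1.2 hcon.1⟩,
              hpos, hlt⟩
          have hside := bookerH_side_re_nonpos hpos w.re hre
          rw [re_add_im] at hside
          calc Real.exp (bookerH w).re * ‖m w‖ ≤ 1 * 1 := by
                gcongr; exact Real.exp_le_one_iff.mpr hside
            _ ≤ Real.exp (5 / T ^ 2) := by simpa using hexp1
        · -- top edge `Im w = T`
          have htop' := bookerH_top_re_le (T := T) hwr hT0
          have hw' : (w.re : ℂ) + T * I = w := by rw [← htop, re_add_im]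
          rw [hw'] at htop'
          calc Real.exp (bookerH w).re * ‖m w‖ ≤ Real.exp (5 / T ^ 2) * 1 := by
                gcongr
            _ = Real.exp (5 / T ^ 2) := mul_one _
      · -- bottom edge `Im w = 0`
        have hw_real : w = (w.re : ℂ) := Complex.ext (by simp) (by simp [← hzero])
        rcases (abs_le.mp hwr).1.lt_or_eq with hgt | heq1
        · rcases (abs_le.mp hwr).2.lt_or_eq with hlt | heq2
          · have hb := bookerH_ofReal_re_nonpos (u := w.re) (abs_lt.mpr ⟨hgt, hlt⟩)
            rw [← hw_real] at hb
            calc Real.exp (bookerH w).re * ‖m w‖ ≤ 1 * 1 := by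
                  gcongr; exact Real.exp_le_one_iff.mpr hb
              _ ≤ Real.exp (5 / T ^ 2) := by simpa using hexp1
          · have : w = 1 := by rw [hw_real, heq2]; simp
            rw [this, hm_one, norm_zero, mul_zero]; positivity
        · have : w = -1 := by rw [hw_real, ← heq1]; simp
          rw [this, hm_negone, norm_zero, mul_zero]; positivity
    have hzU : z ∈ closure U := subset_closure (by
      rw [hU, mem_reProdIm]; exact ⟨abs_lt.mp hzr, hzi, hT⟩)
    have key := Complex.norm_le_of_forall_mem_frontier_norm_le hUb hd hC hzU
    rwa [hnorm_f] at key
  -- Step 2: `ε → 0⁺`.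
  have step2 : ∀ T : ℝ, z.im < T → Real.exp (bookerH z).re ≤ Real.exp (5 / T ^ 2) := by
    intro T hT
    have hden0 : (z - 1 + (0 : ℝ) * I) * (z + 1 + (0 : ℝ) * I) ≠ 0 := by
      simpa using mul_ne_zero hzm1 hzp1
    have hcont : ContinuousAt (fun ε : ℝ =>
        Real.exp (bookerH z).re * ‖(z - 1) * (z + 1) / ((z - 1 + ε * I) * (z + 1 + ε * I))‖) 0 := by
      refine ContinuousAt.mul continuousAt_const (ContinuousAt.norm ?_)
      fun_prop (disch := exact hden0)
    have hval : Real.exp (bookerH z).re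
        * ‖(z - 1) * (z + 1) / ((z - 1 + (0 : ℝ) * I) * (z + 1 + (0 : ℝ) * I))‖
        = Real.exp (bookerH z).re := by
      have : (z - 1) * (z + 1) / ((z - 1 + (0 : ℝ) * I) * (z + 1 + (0 : ℝ) * I)) = 1 := by
        simp only [Complex.ofReal_zero, zero_mul, add_zero]
        exact div_self (mul_ne_zero hzm1 hzp1)
      rw [this, norm_one, mul_one]
    have htend : Tendsto (fun ε : ℝ =>
        Real.exp (bookerH z).re * ‖(z - 1) * (z + 1) / ((z - 1 + ε * I) * (z + 1 + ε * I))‖)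
        (𝓝[>] 0) (𝓝 (Real.exp (bookerH z).re)) := by
      have h := hcont.tendsto
      rw [hval] at h
      exact h.mono_left nhdsWithin_le_nhds
    exact le_of_tendsto htend (eventually_nhdsWithin_of_forall fun ε hε => step1 T hT ε hε)
  -- Step 3: `T → ∞`.
  by_contra hcon
  push Not at hcon
  set r := (bookerH z).re with hr
  obtain ⟨T, hT1, hT2, hT3⟩ : ∃ T : ℝ, z.im < T ∧ 1 ≤ T ∧ 5 / r < T :=
    ⟨max (max (z.im + 1) 1) (5 / r + 1), by simp, by simp, by
      have : 5 / r < 5 / r + 1 := lt_add_one _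
      exact this.trans_le (le_max_right _ _)⟩
  have h := Real.exp_le_exp.mp (step2 T hT1)
  have hT0 : 0 < T := by linarith
  have h5 : 5 < r * T := by
    have := (div_lt_iff₀ hcon).mp hT3
    linarith
  have : 5 / T ^ 2 < r := by
    rw [div_lt_iff₀ (by positivity)]
    nlinarith
  linarith

/-! ### Booker's inequality on the unit strip and the discharge -/

/-- **Booker's inequality on the strip `|Re z| < 1`**:
`∫_0^1 log|(x+1+z)(x+1−z̄)/((x+z)(x−z̄))| dx ≤ log 4 · Re(1/(1+z) + 1/(1−z))`.
[cite: Booker2006, Lemma 4.4] [cite: Trudgian2011, Lemma 2.10] -/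
theorem booker_integral_le_of_abs_re_lt_one {z : ℂ} (hz : |z.re| < 1) :
    ∫ x in (0:ℝ)..1, bookerIntegrand 1 z x ≤ Real.log 4 * (bookerG z).re := by
  -- the case `Im z > 0`
  have upper : ∀ z : ℂ, |z.re| < 1 → 0 < z.im →
      ∫ x in (0:ℝ)..1, bookerIntegrand 1 z x ≤ Real.log 4 * (bookerG z).re := by
    intro z hz hzi
    rw [integral_bookerIntegrand_one_of_im_ne_zero hzi.ne']
    have h := bookerH_re_nonpos hzi hz
    rw [bookerH_re] at h
    linarith
  rcases lt_trichotomy z.im 0 with hneg | hzero | hpos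
  · -- `Im z < 0`: conjugate
    have h := upper (conj z) (by simpa using hz) (by simpa using hneg)
    have e1 : ∀ x : ℝ, bookerIntegrand 1 (conj z) x = bookerIntegrand 1 z x :=
      fun x => bookerIntegrand_conj 1 z x
    have e2 : (bookerG (conj z)).re = (bookerG z).re := by
      have : bookerG (conj z) = conj (bookerG z) := by
        simp only [bookerG, map_add, map_div₀, map_one, map_sub]
      rw [this, Complex.conj_re]
    simp_rw [e1, e2] at h
    exact h
  · -- `Im z = 0`: the real-axis computation
    have hzr : z = (z.re : ℂ) := Complex.ext (by simp) (by simp [hzero])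
    rw [hzr, integral_bookerIntegrand_one_ofReal, ← bookerF_ofReal_re]
    have h := bookerH_ofReal_re_nonpos hz
    rw [bookerH_re] at h
    linarith
  · exact upper z hz hpos

/-- **Discharge of the named fact `Trudgian2011_lemma_2_10`** (Trudgian 2011, Lemma 2.10;
Booker 2006, Lemma 4.4 for `d = 1`): for `½ < d ≤ 1` and `|Re w| ≤ ½`,
`∫_0^d log|(x+d+w)(x+d−w̄)/((x+w)(x−w̄))| dx ≤ d² log 4 · Re(1/(d+w) + 1/(d−w̄))`.
Proof: scaling `x = d·y`, `z = w/d` reduces to `booker_integral_le_of_abs_re_lt_one`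
(`|Re z| ≤ 1/(2d) < 1`). [cite: Trudgian2011, Lemma 2.10] [cite: Booker2006, Lemma 4.4] -/
theorem Trudgian2011_lemma_2_10_holds : Trudgian2011_lemma_2_10 := by
  intro d w hd hd1 hw
  have hd0 : 0 < d := by linarith
  have hz : |(w / d).re| < 1 := by
    rw [Complex.div_ofReal_re, abs_div, abs_of_pos hd0, div_lt_one hd0]
    linarith
  have key := booker_integral_le_of_abs_re_lt_one hz
  rw [integral_bookerIntegrand_scale hd0, mul_assoc (d ^ 2), booker_rhs_scale hd0.ne' w]
  have e : d ^ 2 * (Real.log 4 * (d⁻¹ * (bookerG (w / d)).re))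
      = d * (Real.log 4 * (bookerG (w / d)).re) := by
    field_simp
  rw [e]
  exact mul_le_mul_of_nonneg_left key hd0.le

/-- Booker's original lemma (`d = 1`) as a corollary. [cite: Booker2006, Lemma 4.4] -/
theorem Booker2006_lemma_4_4_holds : Booker2006_lemma_4_4 :=
  Trudgian2011_lemma_2_10_holds.booker

end Literature.NumberTheory.LFunctions
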